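import Summits.QuantumFields.YangMills.Theorems.BalabanUVNodesN11SpaceTruncationDefs
import Summits.QuantumFields.YangMills.Theorems.BalabanUVNodesN11TkReadingSupport
import Summits.QuantumFields.YangMills.Theorems.BalabanUVNodesN11NoExpansionStepSpecificationOfTermRows
import Literature.MathematicalPhysics.QuantumFieldTheory.Balaban1983to89.Node00.Sect2RegionGeometry
import Literature.MathematicalPhysics.QuantumFieldTheory.Balaban1983to89.Node00.BgProvisoRangedOfRecord
import Literature.MathematicalPhysics.QuantumFieldTheory.Balaban1983to89.Node00.Record13SepCoPH

/-!
# DAG node N11 — door (d4): THE SPACE-TRUNCATED §2 WITNESS HAS THE SAME SLOTS ON THE χ-SUPPORT (GIVEN def-R's BACKGROUND PROVISO ON THE READING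
# SUPPORT), SO THE NO-EXPANSION 𝐓-STEP IS SPECIFIED WITHOUT THE 𝐄∕𝐑 TERM ROWS AND WITHOUT THE 𝐁 BOUND ROW

HEADER — WORK-UNIT METADATA.  Cell `pub-ymgap`, YM-PLAN Track A (HUMAN RULING D-0062), seat `pub-ymgap-dag-n11-d` (g11; R134 fan-out seat N11 [B14], strategy s2),
route `BalabanUVNodes`, item K1⁷ `StabilityBAtRecordR13SepCoPH` = stmt-QuantumFields-20542 (helper, `--kind proof --supports 20542 --as helper`, count-neutral).
[III] = [Balaban1988Convergent], [IV] = [Balaban1989LargeFieldI].  Over this seat's `…N11OpenLocusTruncationDefs` ∕ `…N11SpaceTruncationDefs` (door (d4): `truncC`,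
`spaceTrunc`, law transport, the rows as theorems), `…N11TkReadingSupport` (11a's `𝐓_n(s)` reads its operand only on the reading support), p586165
`…N11NoExpansionStepSpecificationOfTermRows` (the specification with six term rows), p583082 `…N11NoExpansionStepSpecification`, p584440 `…N11OperandRowsOfTermRows`,
p585753 `…N11BackgroundCoPMeasurable`, def-R's `Node00.BgProvisoRangedOfRecord` (`BgProvisoΛ`), 12a″ (`TkResidualW.RegOn`).

WHY THIS FILE.  p586165 specifies the no-expansion 𝐓-step at a generic `θ : Stage13HParams` with, per no-expansion history, six rows on the §2 WITNESS's term
values at the parent (measurability of `𝐄 ∕ 𝐑 ∕ 𝐁` read at the embedded background; uniform bounds).  The witness is ∃-bound: such rows are dischargeable only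
from its laws.  This file DISCHARGES FIVE OF THE SIX from the laws — by replacing the witness with its space truncation (`spaceTrunc`, levels `[1, k]`), whose
terms are Borel along the (continuous) embedding of record and uniformly bounded (`…SpaceTruncationDefs` §3) — at the price of rows on PRIMITIVES OF RECORD that
say the ORIGINAL witness is only ever READ inside its analyticity spaces: (a) def-R's ranged background proviso `BgProvisoΛ` ([III] p.259 after (2.28): «(2.7)
imply U_k ∈ U^c_j(X, α_{0,j}, α_{1,j})») over the READING SUPPORT of `𝐓_k(s₀)` — the configurations whose top scale lies in the χ-support and whose scales
`j < k` are `(cR·ε_j)`-regular on the reading regions `Γr s₀ j (Ω^c_{j+1})` (`…TkReadingSupport`); (b) 12a″'s displayed law `RegOn Γr` of the residual serving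
each history (a non-zero `ζ0_j(Y)` forces that regularity — discharged by whoever pins `θ.Zh`); (c) the run's window `InInterval θ.γ k` ([III] (2.46): the
couplings stay in `]0, γ]`, where the laws are stated) with `θ.Admissible` and `θ.s2.Pos` (positive radii `α_{0,j}, α_{1,j}`, `1 ∈ U^c_j`).  The sixth row — JOINT
measurability of `𝐁` in `(U, A)` — stays, for the truncated witness (LOCATED: r11's `LFHypAnalytic.analyticB` is per fixed `a`; no law constrains the
`a`-dependence, so no truncation can produce it).

WHAT THIS FILE PROVES (0 `sorry`, 0 `def`).
* §1 `action23_spaceTrunc_eq_of_mem` ∕ ★ `sect2Operand_spaceTrunc_eq_of_mem` — at a configuration whose background lies in the spaces of record on print's ranges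
  (the body of `BgProvisoΛ`), under the laws at index `n ≤ n₀`, couplings in `[0, γ]`, positive radii and the residual laws: the operand `exp A_n(s)` of the
  truncated family IS the operand of the original.
* §2 ★★ `sect2Slot_spaceTrunc_eq` — on the χ-support, under `BgProvisoΛ` over the reading support and `RegOn`: the §2 slot of the truncated family IS the slot;
  ★★ `hasSect2FormAtZS_spaceTrunc` — the §2 form predicate (laws `LawsRT … k`) transports to the truncated witness family.
* §3 ★★★ `exists_local_witness_clause_succ_of_sLaw₁₃CoPH_of_bgRead` — p586165's specification with the rows `hE ∕ hR ∕ hEb ∕ hRb ∕ hBb` REMOVED (theorems of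
  `…SpaceTruncationDefs` at the record's continuous embedding `continuous_ofBackgroundC_ιSU`), replaced by (a)–(c); the `𝐁` joint-measurability row kept.

HONEST FRAMING.  Helper lane of K1⁷; kernel bookkeeping + elementary complex analysis; nothing of Bałaban's is asserted — (a) is def-R's DISPLAYED proviso
(print-true by [14], [15], (2.7); record row `bg` keys it over the separated (7)-regular support, which is contained in the reading support only through def-R's
located R-half junction «`χ_k(s) ≠ 0 ⇒` top-scale regularity» [RFACE-11d] — NOT proved here), (b) is 12a″'s displayed law, (c) are run ∕ numerics rows.
The expansion steps `Ω_{k+1} ≠ ∅` are untouched ([III] §3 ∕ Thm 2).  N11 NOT discharged; K1⁷ NOT closed; counts unmoved (typed 28∕28 · discharged 5∕27).  One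
finite four-torus programme at fixed `ε = L^{−K}` — NOT ℝ⁴, NOT OS, NOT a mass gap, NOT Clay.  No `sorry`, `axiom`, `def`, `instance`, `notation`.
Sources (SHAPE only): [III] Theorem p.245, (2.7) p.255, (2.10) p.256, (2.17)–(2.18) p.257, (2.20)–(2.28) pp.258–259, (2.30)–(2.31) p.260, (2.34)–(2.42) p.261,
Thm 1 p.262, (2.46) p.263, (3.24)–(3.25) p.270; [IV] (0.2)–(0.3) p.176.
-/

noncomputable section

open MeasureTheory
open scoped BigOperators ENNReal NNReal Matrix.Norms.L2Operator

universe u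

namespace Summit.QuantumFields.YangMills.Theorems.BalabanUVNodesN11SpaceTruncation

open Literature.MathematicalPhysics.QuantumFieldTheory.Balaban1983to89 T4Continuum T4NestedCovariance Node00 Node00.Tk DagBinding
open B15DeterminingSets B8Eq17ClassAkV1 Step B14.Eq227LocalizedTerms B14.Eq225Concrete
open BalabanUVNodesN11FluctTruncationDefs (IsFluctLocal action23_sect2ActionDataOfRecord_congr_fluct_of_isFluctLocal)
open BalabanUVNodesN11OpenLocusTruncationDefs BalabanUVNodesN11SpaceTruncationDefs BalabanUVNodesN11TkReadingSupport
open BalabanUVNodesN11FluctTruncation (sLaw₁₃CoPH_iff_exists_local)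
open BalabanUVNodesN11NoExpansionOldBranchGraph (clause_succ_CoPH_of_Omega_empty_of_pinChi_of_oldBranch_of_clause_of_graph)
open BalabanUVNodesN11OldBranchIntegrableOfDominated (integrable_oldBranch_of_dominated)
open BalabanUVNodesN11OperandRowsOfTermRows (measurable_sect2Operand_of_termRows exists_bound_sect2Operand_of_termBounds)
open BalabanUVNodesN11BackgroundCoPMeasurable (measurable_UbgOfRecord₁₃CoP)

/-! ## §1  The (2.23) action and the operand of the truncated family at a configuration read inside the spaces -/

section Action

variable {P : Params} {𝔸 : Type*} [NormedRing 𝔸] [NormedAlgebra ℂ 𝔸] [CompleteSpace 𝔸] {V : Type u} {M : ℕ} {G : Type*} [GaugeGroup G]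

/-- **THE (2.23) ACTION OF THE TRUNCATED FAMILY IS THE ACTION**, at a background `U` and a level `n ≤ n₀`, PROVIDED: the laws at index `n` hold for `t`; the
couplings `g_{j−1}`, `1 ≤ j ≤ n`, read by (2.23) lie in `[0, γ]`; the vacuum lies in every `U^c_j(X)` ((I.1.15), `Sect2.one_mem_spaceI`); and the background
`(ιU, 0)` lies in `U^c_j(X)` for the domains of the (2.26)–(2.27) ∕ (2.30) ranges and in `Ũ^c_j(X)` for those of the (2.41)(i) range — there the two families
agree term by term (`spaceTrunc_E∕R∕B_eq_of_mem`). [cite: Balaban1988Convergent, (2.23) p.258, (2.26)–(2.28) p.259, (2.30)–(2.31) p.260, (2.41)–(2.42) p.261] -/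
theorem action23_spaceTrunc_eq_of_mem (S : Sect2.Setting 𝔸 G) (Rz : Sect2.Residual P 𝔸) (ν : Stage7Numerics) (g : ℕ → ℝ) (Ω Λ : ℕ → Set (Site P 0))
    (t : Sect2.TermValues P 𝔸 V M) {n n₀ : ℕ} (hn : n ≤ n₀) (a : SFluct P V) (Ek : ℝ) (U : GaugeField P 0 G)
    (hlaw : Sect2.LawsRT (Sect2.towerOfTerms S Rz M Ω t) S.lf n)
    (hg : ∀ j, 1 ≤ j → j ≤ n → 0 ≤ S.flow.g (j - 1) ∧ S.flow.g (j - 1) ≤ S.lf.γ)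
    (h1 : ∀ j, 1 ≤ j → j ≤ n → ∀ X : (Sect2.domSys P M j).Dom,
      Sect2.ofBackgroundC S.ι (1 : GaugeField P 0 G) ∈ Sect2.spaceI S Rz M j (Sect2.domSites P M j X) (S.lf.alpha0 (S.flow.g j)) (S.lf.alpha1 (S.flow.g j)))
    (hI : ∀ j, 1 ≤ j → j ≤ n → ∀ X : (Sect2.domSys P M j).Dom, Sect2.domSites P M j X ⊆ Λ j →
      Sect2.ofBackgroundC S.ι U ∈ Sect2.spaceI S Rz M j (Sect2.domSites P M j X) (S.lf.alpha0 (S.flow.g j)) (S.lf.alpha1 (S.flow.g j)))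
    (hMS : ∀ j, 1 ≤ j → j ≤ n → ∀ X : (Sect2.domSys P M j).Dom, Sect2.admB P ν M g Ω Λ j (Sect2.domSites P M j X) = true →
      Sect2.ofBackgroundC S.ι U ∈ Sect2.spaceMS S Rz M j (Sect2.domSites P M j X) Ω) :
    (Sect2.actionDataOfTerms S Rz ν M g Ω Λ (spaceTrunc S n₀ t) n a Ek).action23 n U = (Sect2.actionDataOfTerms S Rz ν M g Ω Λ t n a Ek).action23 n U := by
  obtain ⟨hH, hA⟩ := hlaw
  rw [Sect2.action23_actionDataOfTerms, Sect2.action23_actionDataOfTerms]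
  have hE : E225 (Sect2.towerOfTerms S Rz M Ω (spaceTrunc S n₀ t)) (fun j X z => Sect2.admE P ν M g Λ j (Sect2.domSites P M j X) z) Rz.phi n U =
      E225 (Sect2.towerOfTerms S Rz M Ω t) (fun j X z => Sect2.admE P ν M g Λ j (Sect2.domSites P M j X) z) Rz.phi n U := by
    unfold E225 EjSub
    refine Finset.sum_congr rfl fun j hj => ?_
    obtain ⟨h1j, hjn⟩ := Finset.mem_Icc.mp hj
    congr 1
    refine Finset.sum_congr rfl fun X _ => Finset.sum_congr rfl fun z _ => ?_
    by_cases hadm : Sect2.admE P ν M g Λ j (Sect2.domSites P M j X) z = true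
    · have hX : Sect2.domSites P M j X ⊆ Λ j := ((Sect2.admE_eq_true_iff ν M g Λ j _ z).mp hadm).2.2
      show (if Sect2.admE P ν M g Λ j (Sect2.domSites P M j X) z = true then
          ((spaceTrunc S n₀ t).E j X z (S.flow.g (j - 1)) (Sect2.ofBackgroundC S.ι U)).re -
            ((spaceTrunc S n₀ t).E j X z (S.flow.g (j - 1)) (Sect2.ofBackgroundC S.ι 1)).re else 0) =
        (if Sect2.admE P ν M g Λ j (Sect2.domSites P M j X) z = true then
          (t.E j X z (S.flow.g (j - 1)) (Sect2.ofBackgroundC S.ι U)).re - (t.E j X z (S.flow.g (j - 1)) (Sect2.ofBackgroundC S.ι 1)).re else 0)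
      rw [if_pos hadm, if_pos hadm,
        spaceTrunc_E_eq_of_mem S n₀ t ⟨h1j, hjn.trans hn⟩ X z _ (hA.analyticE j h1j hjn X z _ (hg j h1j hjn).1 (hg j h1j hjn).2 _ (hI j h1j hjn X hX))
          (lt_of_le_of_lt (hH.boundE j h1j hjn X z _ _ (hg j h1j hjn).1 (hg j h1j hjn).2 (hI j h1j hjn X hX)) (lt_thr_left _ _ _ _)),
        spaceTrunc_E_eq_of_mem S n₀ t ⟨h1j, hjn.trans hn⟩ X z _ (hA.analyticE j h1j hjn X z _ (hg j h1j hjn).1 (hg j h1j hjn).2 _ (h1 j h1j hjn X))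
          (lt_of_le_of_lt (hH.boundE j h1j hjn X z _ _ (hg j h1j hjn).1 (hg j h1j hjn).2 (h1 j h1j hjn X)) (lt_thr_left _ _ _ _))]
    · show (if Sect2.admE P ν M g Λ j (Sect2.domSites P M j X) z = true then
          ((spaceTrunc S n₀ t).E j X z (S.flow.g (j - 1)) (Sect2.ofBackgroundC S.ι U)).re -
            ((spaceTrunc S n₀ t).E j X z (S.flow.g (j - 1)) (Sect2.ofBackgroundC S.ι 1)).re else 0) =
        (if Sect2.admE P ν M g Λ j (Sect2.domSites P M j X) z = true then
          (t.E j X z (S.flow.g (j - 1)) (Sect2.ofBackgroundC S.ι U)).re - (t.E j X z (S.flow.g (j - 1)) (Sect2.ofBackgroundC S.ι 1)).re else 0)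
      rw [if_neg hadm, if_neg hadm]
  have hR : R230 (Sect2.towerOfTerms S Rz M Ω (spaceTrunc S n₀ t)) (fun j X => Sect2.admR P ν M g Λ j (Sect2.domSites P M j X)) n U =
      R230 (Sect2.towerOfTerms S Rz M Ω t) (fun j X => Sect2.admR P ν M g Λ j (Sect2.domSites P M j X)) n U := by
    unfold R230
    refine Finset.sum_congr rfl fun j hj => Finset.sum_congr rfl fun X _ => ?_
    obtain ⟨h1j, hjn⟩ := Finset.mem_Icc.mp hj
    by_cases hadm : Sect2.admR P ν M g Λ j (Sect2.domSites P M j X) = true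
    · have hX : Sect2.domSites P M j X ⊆ Λ j :=
        ((Sect2.admR_eq_true_iff ν M g Λ j _).mp hadm).trans (Sect2.innerT_subset _ 1 (Λ j))
      show (if Sect2.admR P ν M g Λ j (Sect2.domSites P M j X) = true then
          ((spaceTrunc S n₀ t).R j X (Sect2.ofBackgroundC S.ι U)).re - ((spaceTrunc S n₀ t).R j X (Sect2.ofBackgroundC S.ι 1)).re else 0) =
        (if Sect2.admR P ν M g Λ j (Sect2.domSites P M j X) = true then
          (t.R j X (Sect2.ofBackgroundC S.ι U)).re - (t.R j X (Sect2.ofBackgroundC S.ι 1)).re else 0)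
      rw [if_pos hadm, if_pos hadm,
        spaceTrunc_R_eq_of_mem S n₀ t ⟨h1j, hjn.trans hn⟩ X (hA.analyticR j h1j hjn X _ (hI j h1j hjn X hX))
          (lt_of_le_of_lt (hH.boundR j h1j hjn X _ (hI j h1j hjn X hX)) (lt_thr_left _ _ _ _)),
        spaceTrunc_R_eq_of_mem S n₀ t ⟨h1j, hjn.trans hn⟩ X (hA.analyticR j h1j hjn X _ (h1 j h1j hjn X))
          (lt_of_le_of_lt (hH.boundR j h1j hjn X _ (h1 j h1j hjn X)) (lt_thr_left _ _ _ _))]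
    · show (if Sect2.admR P ν M g Λ j (Sect2.domSites P M j X) = true then
          ((spaceTrunc S n₀ t).R j X (Sect2.ofBackgroundC S.ι U)).re - ((spaceTrunc S n₀ t).R j X (Sect2.ofBackgroundC S.ι 1)).re else 0) =
        (if Sect2.admR P ν M g Λ j (Sect2.domSites P M j X) = true then
          (t.R j X (Sect2.ofBackgroundC S.ι U)).re - (t.R j X (Sect2.ofBackgroundC S.ι 1)).re else 0)
      rw [if_neg hadm, if_neg hadm]
  have hB : B240 (Sect2.towerOfTerms S Rz M Ω (spaceTrunc S n₀ t)) (fun j X => Sect2.admB P ν M g Ω Λ j (Sect2.domSites P M j X)) a n U =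
      B240 (Sect2.towerOfTerms S Rz M Ω t) (fun j X => Sect2.admB P ν M g Ω Λ j (Sect2.domSites P M j X)) a n U := by
    unfold B240
    refine Finset.sum_congr rfl fun j hj => Finset.sum_congr rfl fun X _ => ?_
    obtain ⟨h1j, hjn⟩ := Finset.mem_Icc.mp hj
    by_cases hadm : Sect2.admB P ν M g Ω Λ j (Sect2.domSites P M j X) = true
    · show (if Sect2.admB P ν M g Ω Λ j (Sect2.domSites P M j X) = true then ((spaceTrunc S n₀ t).B j X (Sect2.ofBackgroundC S.ι U) a).re else 0) =
        (if Sect2.admB P ν M g Ω Λ j (Sect2.domSites P M j X) = true then (t.B j X (Sect2.ofBackgroundC S.ι U) a).re else 0)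
      rw [if_pos hadm, if_pos hadm,
        spaceTrunc_B_eq_of_mem S n₀ t ⟨h1j, hjn.trans hn⟩ X a (hA.analyticB j h1j hjn X a _ (hMS j h1j hjn X hadm))
          (lt_of_le_of_lt (hH.boundB j h1j hjn X _ a (hMS j h1j hjn X hadm)) (lt_thr_left _ _ _ _))]
    · show (if Sect2.admB P ν M g Ω Λ j (Sect2.domSites P M j X) = true then ((spaceTrunc S n₀ t).B j X (Sect2.ofBackgroundC S.ι U) a).re else 0) =
        (if Sect2.admB P ν M g Ω Λ j (Sect2.domSites P M j X) = true then (t.B j X (Sect2.ofBackgroundC S.ι U) a).re else 0)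
      rw [if_neg hadm, if_neg hadm]
  rw [hE, hR, hB]

end Action

/-! ## §2  On the χ-support the slot of the truncated family IS the slot; the §2 form predicate transports -/

section Slot

variable {F : T4Family} {N : ℕ} [NeZero N] {V : Type} [NormedAddCommGroup V] [InnerProductSpace ℝ V] [FiniteDimensional ℝ V] [MeasurableSpace V] [BorelSpace V]
variable {𝔸 : Type*} [NormedRing 𝔸] [NormedAlgebra ℂ 𝔸] [CompleteSpace 𝔸]
variable {ν : Stage7Numerics} {M : ℕ} {g : ℕ → ℝ} {K : ℕ}

/-- **★★ THE §2 SLOT OF THE TRUNCATED FAMILY IS THE SLOT** at `V_n`, PROVIDED: every non-zero generation weight `ζ_j(Ω^c_{j+1}(s))` forces a property `Reg j` of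
the scale-`j` gauge variables (`hζ`); at every configuration `𝐖` with top scale `V_n` and `Reg j (𝐖 j)` for `j < n` the background `U(𝐖)` lies in the spaces of
record on print's ranges (`hbg`, the body of def-R's `BgProvisoΛ`); the laws at index `n ≤ n₀`; couplings in `[0, γ]`; the vacuum in every `U^c_j(X)`.
[cite: Balaban1988Convergent, (2.18) p.257, (2.20)–(2.23) p.258, (2.26)–(2.28) p.259, (2.30)–(2.31) p.260, (2.41)–(2.42) p.261, (2.10) p.256] -/
theorem sect2Slot_spaceTrunc_eq (Sg : Sect2.Setting 𝔸 (SU N)) (Rz : Sect2.Residual (F.P K) 𝔸) (W : TkWeights F N V K) {n n₀ : ℕ} (hn : n ≤ n₀)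
    (s : SeqOfRecord F ν M g K n) (Reg : (j : ℕ) → GaugeField (F.P K) j (SU N) → Prop)
    (hζ : ∀ j, j < n → ∀ ω : MultiCfg (F.P K) (SU N) V, W.ζ j (s.Ω (j + 1))ᶜ ω ≠ 0 → Reg j (ω j).1)
    (t : Sect2.TermValues (F.P K) 𝔸 V M) (Ek : ℝ) (U : BgMap F N K) (Vn : GaugeField (F.P K) n (SU N))
    (hlaw : Sect2.LawsRT (sect2TowerOfRecord F N V K Sg Rz s t) Sg.lf n)
    (hg : ∀ j, 1 ≤ j → j ≤ n → 0 ≤ Sg.flow.g (j - 1) ∧ Sg.flow.g (j - 1) ≤ Sg.lf.γ)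
    (h1 : ∀ j, 1 ≤ j → j ≤ n → ∀ X : (Sect2.domSys (F.P K) M j).Dom,
      Sect2.ofBackgroundC Sg.ι (1 : GaugeField (F.P K) 0 (SU N)) ∈
        Sect2.spaceI Sg Rz M j (Sect2.domSites (F.P K) M j X) (Sg.lf.alpha0 (Sg.flow.g j)) (Sg.lf.alpha1 (Sg.flow.g j)))
    (hbg : ∀ Wc : MSField (F.P K) (SU N), Wc n = Vn → (∀ j, j < n → Reg j (Wc j)) → ∀ j, 1 ≤ j → j ≤ n → ∀ X : (Sect2.domSys (F.P K) M j).Dom,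
      (Sect2.domSites (F.P K) M j X ⊆ s.Λ j →
        Sect2.ofBackgroundC Sg.ι (U Wc) ∈ Sect2.spaceI Sg Rz M j (Sect2.domSites (F.P K) M j X) (Sg.lf.alpha0 (Sg.flow.g j)) (Sg.lf.alpha1 (Sg.flow.g j))) ∧
      (Sect2.admB (F.P K) ν M g s.Ω s.Λ j (Sect2.domSites (F.P K) M j X) = true →
        Sect2.ofBackgroundC Sg.ι (U Wc) ∈ Sect2.spaceMS Sg Rz M j (Sect2.domSites (F.P K) M j X) s.Ω)) :
    sect2Slot F N V K Sg Rz W s (spaceTrunc Sg n₀ t) Ek U Vn = sect2Slot F N V K Sg Rz W s t Ek U Vn :=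
  sect2Slot_congr_on_read ν M g K W Sg Rz s Reg hζ _ _ Ek Ek U U Vn fun a Wc hW hR => by
    show Real.exp ((Sect2.actionDataOfTerms Sg Rz ν M g s.Ω s.Λ (spaceTrunc Sg n₀ t) n a Ek).action23 n (U Wc)) =
      Real.exp ((Sect2.actionDataOfTerms Sg Rz ν M g s.Ω s.Λ t n a Ek).action23 n (U Wc))
    rw [action23_spaceTrunc_eq_of_mem Sg Rz ν g s.Ω s.Λ t hn a Ek (U Wc) hlaw hg h1 (fun j h1j hjn X hX => (hbg Wc hW hR j h1j hjn X).1 hX)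
      (fun j h1j hjn X hadm => (hbg Wc hW hR j h1j hjn X).2 hadm)]

/-- **★★ THE §2 FORM PREDICATE (laws `LawsRT … k`, history-indexed residual ∕ weights ∕ background) TRANSPORTS TO THE TRUNCATED WITNESS FAMILY**: universality of
`𝐄` and the laws transport (`…SpaceTruncationDefs` §2), and the identity clause holds a.e. on the χ-support because the slot is unchanged there (§2 above, with the
top scale of the reading support IN the χ-support). [cite: Balaban1988Convergent, (2.17)–(2.18) p.257, Thm 1 p.262, (2.28) p.259, (2.10) p.256] -/
theorem hasSect2FormAtZS_spaceTrunc (Sg : Sect2.Setting 𝔸 (SU N)) {k n₀ : ℕ} (hk : k ≤ n₀) (Rz : SeqOfRecord F ν M g K k → Sect2.Residual (F.P K) 𝔸)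
    (W : SeqOfRecord F ν M g K k → TkWeights F N V K) (U : SeqOfRecord F ν M g K k → BgMap F N K)
    (slot : SeqOfRecord F ν M g K k → Density (F.P K) k (SU N))
    (Reg : SeqOfRecord F ν M g K k → (j : ℕ) → GaugeField (F.P K) j (SU N) → Prop)
    (hζ : ∀ s₀ j, j < k → ∀ ω : MultiCfg (F.P K) (SU N) V, (W s₀).ζ j (s₀.Ω (j + 1))ᶜ ω ≠ 0 → Reg s₀ j (ω j).1)
    (hg : ∀ j, 1 ≤ j → j ≤ k → 0 ≤ Sg.flow.g (j - 1) ∧ Sg.flow.g (j - 1) ≤ Sg.lf.γ)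
    (h1 : ∀ s₀ j, 1 ≤ j → j ≤ k → ∀ X : (Sect2.domSys (F.P K) M j).Dom,
      Sect2.ofBackgroundC Sg.ι (1 : GaugeField (F.P K) 0 (SU N)) ∈
        Sect2.spaceI Sg (Rz s₀) M j (Sect2.domSites (F.P K) M j X) (Sg.lf.alpha0 (Sg.flow.g j)) (Sg.lf.alpha1 (Sg.flow.g j)))
    (hbg : ∀ s₀ (Wc : MSField (F.P K) (SU N)), chiSeqOfRecord F N ν M g K k s₀ (Wc k) ≠ 0 → (∀ j, j < k → Reg s₀ j (Wc j)) →
      ∀ j, 1 ≤ j → j ≤ k → ∀ X : (Sect2.domSys (F.P K) M j).Dom,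
      (Sect2.domSites (F.P K) M j X ⊆ s₀.Λ j →
        Sect2.ofBackgroundC Sg.ι (U s₀ Wc) ∈ Sect2.spaceI Sg (Rz s₀) M j (Sect2.domSites (F.P K) M j X) (Sg.lf.alpha0 (Sg.flow.g j)) (Sg.lf.alpha1 (Sg.flow.g j))) ∧
      (Sect2.admB (F.P K) ν M g s₀.Ω s₀.Λ j (Sect2.domSites (F.P K) M j X) = true →
        Sect2.ofBackgroundC Sg.ι (U s₀ Wc) ∈ Sect2.spaceMS Sg (Rz s₀) M j (Sect2.domSites (F.P K) M j X) s₀.Ω))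
    {t : SeqOfRecord F ν M g K k → Sect2.TermValues (F.P K) 𝔸 V M} {Ek : SeqOfRecord F ν M g K k → ℝ}
    (h : HasSect2FormAtZS F N V K Sg k Rz W U (fun s₀ t₀ => Sect2.LawsRT (sect2TowerOfRecord F N V K Sg (Rz s₀) s₀ t₀) Sg.lf k) slot t Ek) :
    HasSect2FormAtZS F N V K Sg k Rz W U (fun s₀ t₀ => Sect2.LawsRT (sect2TowerOfRecord F N V K Sg (Rz s₀) s₀ t₀) Sg.lf k) slot
      (fun s₀ => spaceTrunc Sg n₀ (t s₀)) Ek := by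
  refine ⟨universalE_spaceTrunc h.1 Sg n₀, fun s₀ => ⟨lawsRT_spaceTrunc Sg (Rz s₀) s₀.Ω (t s₀) hk (h.2 s₀).1, ?_⟩⟩
  rcases (h.2 s₀).2 with h0 | hae
  · exact Or.inl h0
  · refine Or.inr ?_
    filter_upwards [hae] with Vn hVn hχ
    rw [hVn hχ]
    exact (sect2Slot_spaceTrunc_eq Sg (Rz s₀) (W s₀) hk s₀ (Reg s₀) (hζ s₀) (t s₀) (Ek s₀) (U s₀) Vn (h.2 s₀).1 hg (h1 s₀)
      (fun Wc hW hR => hbg s₀ Wc (by rw [hW]; exact hχ) hR)).symm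

end Slot

/-! ## §3  AT THE RECORD: the no-expansion 𝐓-step specified with the 𝐄∕𝐑 rows and the 𝐁 bound row DISCHARGED -/

section Record

variable {F : T4Family} {N : ℕ} [NeZero N]

variable (θ : Stage13HParams F N) (p : B12.RunParams)

/-- **★★★ THE SPECIFICATION OF THE NO-EXPANSION 𝐓-STEP AT A GENERIC STAGE-13 PARAMETER WITH THE 𝐄∕𝐑 TERM ROWS AND THE 𝐁 BOUND ROW DISCHARGED.**  As p586165's
`exists_local_witness_clause_succ_of_sLaw₁₃CoPH_of_termRows`, with its rows «`𝐄`, `𝐑` measurable at the embedded background; `𝐄`, `𝐑`, `𝐁` uniformly bounded» REMOVED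
(theorems for the space-truncated witness), and instead: the run's window `InInterval θ.γ k` with `θ.Admissible`, `θ.s2.Pos`; 12a″'s displayed law `RegOn (Γr s₀)`
of the residual serving every history; def-R's ranged background proviso `BgProvisoΛ` at the Co-class background OVER THE READING SUPPORT (top scale in the
χ-support, scales `j < k` regular at `cR·ε_j` on the reading regions `Γr s₀ j (Ω^c_{j+1})`).  The row «`𝐁` jointly measurable in `(U, A)`» stays (LOCATED: no law
on the `a`-dependence).  Conclusion VERBATIM p586165's. [cite: Balaban1988Convergent, Theorem p.245, Thm 1 p.262, (2.7) p.255, (2.10) p.256, (2.18) p.257, (2.20)–(2.28) pp.258–259, (2.31) p.260, (2.41)–(2.42) p.261, (2.46) p.263, (3.24)–(3.25) p.270; Balaban1989LargeFieldI, (0.2)–(0.3) p.176] -/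
theorem exists_local_witness_clause_succ_of_sLaw₁₃CoPH_of_bgRead (h : θ.Provisos₁₃CoPH F N) (hU : θ.ZhUnity F N) (hθ : θ.Admissible F N) (hpos : θ.s2.Pos)
    {k : ℕ} (hk : k < p.K) (hM : 1 ≤ θ.τ9.M) (hw : Step.InInterval θ.γ k (gOfRecord₁₃ F N θ.toStage13Params p))
    (cR : ℝ) (Γr : SeqOfRecord F θ.ν θ.τ9.M (gOfRecord₁₃ F N θ.toStage13Params p) p.K k → ℕ → Set (Site (F.P p.K) 0) → Set (Site (F.P p.K) 0))
    (hreg : ∀ s₀, (θ.zhAt p s₀).RegOn F N (FluctV N) θ.ν cR p (gOfRecord₁₃ F N θ.toStage13Params p) (Γr s₀))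
    (hbg : BgProvisoΛ F N p.K (settingOfRecord₁₃ F N θ.toStage13Params p) (θ.Rz p.K) θ.τ9.M k
      (fun s₀ => {Wc | chiSeqOfRecord F N θ.ν θ.τ9.M (gOfRecord₁₃ F N θ.toStage13Params p) p.K k s₀ (Wc k) ≠ 0 ∧
        ∀ j, j < k → PlaqSmallOn (plaqsOf (pts j (Γr s₀ j (s₀.Ω (j + 1))ᶜ))) (cR * epsOfRecord θ.ν (gOfRecord₁₃ F N θ.toStage13Params p) j) (Wc j)})
      (UbgOfRecord₁₃CoP F N θ.toStage13Params p k))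
    (hS : SLaw₁₃CoPH F N θ p k) :
    ∃ (t : SeqOfRecord F θ.ν θ.τ9.M (gOfRecord₁₃ F N θ.toStage13Params p) p.K k → Sect2.TermValues (F.P p.K) (MatA N) (FluctV N) θ.τ9.M)
      (Ek : SeqOfRecord F θ.ν θ.τ9.M (gOfRecord₁₃ F N θ.toStage13Params p) p.K k → ℝ),
      HasSect2FormAtZS F N (FluctV N) p.K (settingOfRecord₁₃ F N θ.toStage13Params p) k (θ.rzAt p) (WtOfRecord₁₃H F N θ p)
          (UbgOfRecord₁₃CoP F N θ.toStage13Params p k)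
          (fun s₀ t₀ => Sect2.LawsRT (sect2TowerOfRecord F N (FluctV N) p.K (settingOfRecord₁₃ F N θ.toStage13Params p) (θ.rzAt p s₀) s₀ t₀)
            (settingOfRecord₁₃ F N θ.toStage13Params p).lf k)
          (slotsOfRecord F N θ.ν θ.τ9 (EOfRecord₁₃ F N θ.toStage13Params) (wOfRecord₉ F N θ.toStage9Params) θ.ppSel p
            (gOfRecord₁₃ F N θ.toStage13Params p) k) t Ek ∧
      (∀ s₀, IsFluctLocal k (t s₀)) ∧
      ∀ (s : SeqOfRecord F θ.ν θ.τ9.M (gOfRecord₁₃ F N θ.toStage13Params p) p.K (k + 1)), s.Ω (k + 1) = ∅ →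
        -- (P) prefix agreement below `k`
        (∀ j, j < k → (θ.zhAt p s).ζ0 j = (θ.zhAt p s.init).ζ0 j ∧ (θ.zhAt p s).quad j = (θ.zhAt p s.init).quad j) →
        -- (V) the generation-`k` pin with the old front factor
        (∀ (V' : GaugeField (F.P p.K) (k + 1) (SU N)) (U₀ : GaugeField (F.P p.K) k (SU N)),
          (θ.zhAt p s).ζ0 k Set.univ (pairCfgAt (V := FluctV N) k V' U₀) =
            chiSeqOfRecord F N θ.ν θ.τ9.M (gOfRecord₁₃ F N θ.toStage13Params p) p.K k s.init U₀ *
              wOfRecord₉ F N θ.toStage9Params p (gOfRecord₁₃ F N θ.toStage13Params p) k s U₀ ((avOfRecord F N p.K k).avg U₀)) →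
        -- `quad_k(∅) = 0` on the two-scale configurations
        (∀ (V' : GaugeField (F.P p.K) (k + 1) (SU N)) (U₀ : GaugeField (F.P p.K) k (SU N)), (θ.zhAt p s).quad k ∅ (pairCfgAt (V := FluctV N) k V' U₀) = 0) →
        -- `k`-locality of `quad_j(Λ_{j+1})`, `j < k`
        (∀ j, j < k → ∀ ω ω' : MultiCfg (F.P p.K) (SU N) (FluctV N), (∀ i, i ≤ k → ω i = ω' i) →
          (θ.zhAt p s).quad j (s.init.Λ (j + 1)) ω = (θ.zhAt p s).quad j (s.init.Λ (j + 1)) ω') →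
        -- measurability of the residual serving `s′`
        (∀ j (Y : Set (Site (F.P p.K) 0)), Measurable ((θ.zhAt p s).ζ0 j Y)) →
        (∀ j (Λ' : Set (Site (F.P p.K) 0)), Measurable ((θ.zhAt p s).quad j Λ')) →
        -- per old branch: A-fibre domination (K0b)
        (∀ S ∈ admSOfRecord F θ.ν θ.τ9.M (gOfRecord₁₃ F N θ.toStage13Params p) p.K k s.init, ∀ j : ℕ,
          ∃ ŵ : (↥(Set.toFinite (B10Eq42TorusConstraint.bondsIn j ((s.init.Λ (j + 1))ᶜ ∩ s.init.Ω (j + 1)))).toFinset → FluctV N) → ℝ≥0∞, Measurable ŵ ∧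
            (∫⁻ a, ŵ a ∂(Measure.pi fun _ : ↥(Set.toFinite (B10Eq42TorusConstraint.bondsIn j ((s.init.Λ (j + 1))ᶜ ∩ s.init.Ω (j + 1)))).toFinset => (volume : Measure (FluctV N)))) ≠ ⊤ ∧
            ∀ ω, ENNReal.ofReal ((WtOfRecord₁₃H F N θ p s).w j (s.init.Λ (j + 1)) ((s.init.Λ (j + 1))ᶜ ∩ s.init.Ω (j + 1)) (S (j + 1)) ω) ≤
              ŵ (fun b : ↥(Set.toFinite (B10Eq42TorusConstraint.bondsIn j ((s.init.Λ (j + 1))ᶜ ∩ s.init.Ω (j + 1)))).toFinset => (ω j).2 b)) →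
        -- def-T: the 𝐁-terms of the witness at the parent history, READ AT THE EMBEDDED BACKGROUND, are JOINTLY measurable in `(U, A)` (LOCATED residue)
        (∀ (S' : ℕ → Set (Site (F.P p.K) 0)) (j : ℕ) (X : (Sect2.domSys (F.P p.K) θ.τ9.M j).Dom),
          Measurable (fun q : GaugeField (F.P p.K) 0 (SU N) × MSFluct (F.P p.K) (FluctV N) =>
            ((t s.init).B j X (Sect2.ofBackgroundC (settingOfRecord₁₃ F N θ.toStage13Params p).ι q.1) (S', q.2)).re)) →
        (slotsTOfRecord F N θ.ν θ.τ9 (EOfRecord₁₃ F N θ.toStage13Params) (wOfRecord₉ F N θ.toStage9Params) θ.ppSel p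
            (gOfRecord₁₃ F N θ.toStage13Params p) (k + 1) s = 0 ∨
          ∀ᵐ V' ∂fieldMeasure (F.P p.K) (k + 1) (SU N),
            chiSeqOfRecord F N θ.ν θ.τ9.M (gOfRecord₁₃ F N θ.toStage13Params p) p.K (k + 1) s V' ≠ 0 →
              slotsTOfRecord F N θ.ν θ.τ9 (EOfRecord₁₃ F N θ.toStage13Params) (wOfRecord₉ F N θ.toStage9Params) θ.ppSel p
                  (gOfRecord₁₃ F N θ.toStage13Params p) (k + 1) s V' =
                sect2Slot F N (FluctV N) p.K (settingOfRecord₁₃ F N θ.toStage13Params p) (θ.rzAt p s) (WtOfRecord₁₃H F N θ p s) s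
                  (t s.init) (Ek s.init) (UbgOfRecord₁₃CoP F N θ.toStage13Params p (k + 1) s) V') := by
  obtain ⟨t, Ek, hform, hloc⟩ := (sLaw₁₃CoPH_iff_exists_local θ p k).1 hS
  -- the run's window: couplings `g_{j−1} ∈ [0, γ]`, positive radii, the vacuum in every `U^c_j(X)`
  have hg : ∀ j, 1 ≤ j → j ≤ k → 0 ≤ (settingOfRecord₁₃ F N θ.toStage13Params p).flow.g (j - 1) ∧
      (settingOfRecord₁₃ F N θ.toStage13Params p).flow.g (j - 1) ≤ (settingOfRecord₁₃ F N θ.toStage13Params p).lf.γ :=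
    fun j _ hj => ⟨(hw (j - 1) (by omega)).1.le, (hw (j - 1) (by omega)).2⟩
  have h1 : ∀ (s₀ : SeqOfRecord F θ.ν θ.τ9.M (gOfRecord₁₃ F N θ.toStage13Params p) p.K k) (j : ℕ), 1 ≤ j → j ≤ k →
      ∀ X : (Sect2.domSys (F.P p.K) θ.τ9.M j).Dom,
      Sect2.ofBackgroundC (settingOfRecord₁₃ F N θ.toStage13Params p).ι (1 : GaugeField (F.P p.K) 0 (SU N)) ∈
        Sect2.spaceI (settingOfRecord₁₃ F N θ.toStage13Params p) (θ.rzAt p s₀) θ.τ9.M j (Sect2.domSites (F.P p.K) θ.τ9.M j X)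
          ((settingOfRecord₁₃ F N θ.toStage13Params p).lf.alpha0 ((settingOfRecord₁₃ F N θ.toStage13Params p).flow.g j))
          ((settingOfRecord₁₃ F N θ.toStage13Params p).lf.alpha1 ((settingOfRecord₁₃ F N θ.toStage13Params p).flow.g j)) :=
    fun s₀ j _ hj X => Sect2.one_mem_spaceI _ (settingOfRecord₁₃_pos F N θ.toStage13Params hpos p).cB_pos (h.rzAtLaws p s₀) θ.τ9.M j _
      (alphaPos₁₃_of_inInterval hθ hw hj).1 (alphaPos₁₃_of_inInterval hθ hw hj).2
  have hformT := hasSect2FormAtZS_spaceTrunc (settingOfRecord₁₃ F N θ.toStage13Params p) (le_refl k) (θ.rzAt p) (WtOfRecord₁₃H F N θ p)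
    (UbgOfRecord₁₃CoP F N θ.toStage13Params p k) _
    (fun s₀ j U₀ => PlaqSmallOn (plaqsOf (pts j (Γr s₀ j (s₀.Ω (j + 1))ᶜ))) (cR * epsOfRecord θ.ν (gOfRecord₁₃ F N θ.toStage13Params p) j) U₀)
    (fun s₀ j _ ω hz => plaqSmallOn_readOn_of_zetaP_ne_zero (hreg s₀) s₀.Ω j hz) hg h1
    (fun s₀ Wc hχ hR j h1j hjk X => hbg s₀ Wc ⟨hχ, hR⟩ j h1j hjk X) hform
  refine ⟨fun s₀ => spaceTrunc (settingOfRecord₁₃ F N θ.toStage13Params p) k (t s₀), Ek, hformT,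
    fun s₀ => isFluctLocal_spaceTrunc (hloc s₀) _ k, fun s hΩ hpre hZ hq hqloc hζm hqm hW hB => ?_⟩
  refine clause_succ_CoPH_of_Omega_empty_of_pinChi_of_oldBranch_of_clause_of_graph θ p h hk hM s hΩ hqloc hpre
    (spaceTrunc (settingOfRecord₁₃ F N θ.toStage13Params p) k (t s.init)) (Ek s.init)
    (fun S a a' Uf ha => action23_sect2ActionDataOfRecord_congr_fluct_of_isFluctLocal p.K _ _ s.init (isFluctLocal_spaceTrunc (hloc s.init) _ k)
      (Ek s.init) S a a' ha Uf)
    (hformT.2 s.init).2 hZ hq fun S hSm => ?_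
  choose ŵ hŵm hŵfin hdom using hW S hSm
  haveI : BorelSpace (GaugeField (F.P p.K) 0 (SU N)) := inferInstanceAs (BorelSpace (PBond (F.P p.K) 0 → SU N))
  have hcont : Continuous fun U : GaugeField (F.P p.K) 0 (SU N) => Sect2.ofBackgroundC (settingOfRecord₁₃ F N θ.toStage13Params p).ι U :=
    continuous_ofBackgroundC_ιSU
  have hΦm := measurable_sect2Operand_of_termRows p.K (settingOfRecord₁₃ F N θ.toStage13Params p) (θ.rzAt p s.init) s.init
    (spaceTrunc (settingOfRecord₁₃ F N θ.toStage13Params p) k (t s.init)) (Ek s.init) (measurable_UbgOfRecord₁₃CoP F N θ.toStage13Params p k s.init) S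
    (fun j X z g' => measurable_re_spaceTrunc_E_comp _ k (t s.init) hcont j X z g')
    (fun j X => measurable_re_spaceTrunc_R_comp _ k (t s.init) hcont j X) (hB S)
  obtain ⟨CE, hCE⟩ := exists_bound_spaceTrunc_E (settingOfRecord₁₃ F N θ.toStage13Params p) k (t s.init)
  obtain ⟨CR, hCR⟩ := exists_bound_spaceTrunc_R (settingOfRecord₁₃ F N θ.toStage13Params p) k (t s.init)
  obtain ⟨CB, hCB⟩ := exists_bound_spaceTrunc_B (settingOfRecord₁₃ F N θ.toStage13Params p) k (t s.init)
  obtain ⟨CΦ, hΦle⟩ := exists_bound_sect2Operand_of_termBounds p.K (settingOfRecord₁₃ F N θ.toStage13Params p) (θ.rzAt p s.init) s.init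
    (spaceTrunc (settingOfRecord₁₃ F N θ.toStage13Params p) k (t s.init)) (Ek s.init) (UbgOfRecord₁₃CoP F N θ.toStage13Params p k s.init)
    ⟨CE, fun j X z g' U => hCE j X z g' _⟩ ⟨CR, fun j X U => hCR j X _⟩ ⟨CB, fun j X U a => hCB j X _ a⟩
  exact integrable_oldBranch_of_dominated θ p h.zhLaws hU s S hζm hqm ŵ hŵm
    (fun j => (∫⁻ a, ŵ j a ∂(Measure.pi fun _ : ↥(Set.toFinite (B10Eq42TorusConstraint.bondsIn j ((s.init.Λ (j + 1))ᶜ ∩ s.init.Ω (j + 1)))).toFinset => (volume : Measure (FluctV N)))).toNNReal)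
    (fun j => le_of_eq (ENNReal.coe_toNNReal (hŵfin j)).symm) hdom
    (Φ := sect2Operand F N (FluctV N) p.K (settingOfRecord₁₃ F N θ.toStage13Params p) (θ.rzAt p s.init) s.init
      (spaceTrunc (settingOfRecord₁₃ F N θ.toStage13Params p) k (t s.init)) (Ek s.init) (UbgOfRecord₁₃CoP F N θ.toStage13Params p k s.init))
    hΦm (fun a U => (sect2Operand_pos p.K _ _ s.init _ (Ek s.init) _ a U).le) CΦ hΦle

/-- **AT A PARAMETER WITH THE SEPARATED-RANGE PROVISOS**: the same, with the background proviso taken from the record's row `Provisos₁₃SepCoPH.bg` (over the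
separated (7)-regular support `suppOfRecord₁₃SepCoP`, under the window `InInterval θ.γ k` and `PartCompat₁₃`), GIVEN the JUNCTION «reading support ⊆ separated
(7)-regular support» (`hJ`: def-R's located R-half of [RFACE-11d] — top-scale regularity from `χ_k(s) ≠ 0`, the separation of `s`, the (7)-smallness at the top —
a K0 ∕ def-R row, NOT proved here). [cite: Balaban1988Convergent, Theorem p.245, Thm 1 p.262, (2.7) p.255, (2.10) p.256, (2.28) p.259, (3.24)–(3.25) p.270; Balaban1985RegularSpaces, (1.3)–(1.6) p.77] -/
theorem exists_local_witness_clause_succ_of_sLaw₁₃CoPH_of_sep_of_junction (hsep : θ.Provisos₁₃SepCoPH F N) (hU : θ.ZhUnity F N) (hθ : θ.Admissible F N)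
    (hpos : θ.s2.Pos) {k : ℕ} (hk : k < p.K) (hM : 1 ≤ θ.τ9.M) (hw : Step.InInterval θ.γ k (gOfRecord₁₃ F N θ.toStage13Params p))
    (hPC : PartCompat₁₃ F N θ.toStage13Params p k) (cR : ℝ)
    (Γr : SeqOfRecord F θ.ν θ.τ9.M (gOfRecord₁₃ F N θ.toStage13Params p) p.K k → ℕ → Set (Site (F.P p.K) 0) → Set (Site (F.P p.K) 0))
    (hreg : ∀ s₀, (θ.zhAt p s₀).RegOn F N (FluctV N) θ.ν cR p (gOfRecord₁₃ F N θ.toStage13Params p) (Γr s₀))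
    (hJ : ∀ s₀ (Wc : MSField (F.P p.K) (SU N)), chiSeqOfRecord F N θ.ν θ.τ9.M (gOfRecord₁₃ F N θ.toStage13Params p) p.K k s₀ (Wc k) ≠ 0 →
      (∀ j, j < k → PlaqSmallOn (plaqsOf (pts j (Γr s₀ j (s₀.Ω (j + 1))ᶜ))) (cR * epsOfRecord θ.ν (gOfRecord₁₃ F N θ.toStage13Params p) j) (Wc j)) →
      Wc ∈ suppOfRecord₁₃SepCoP F N θ.toStage13Params p k s₀)
    (hS : SLaw₁₃CoPH F N θ p k) :
    ∃ (t : SeqOfRecord F θ.ν θ.τ9.M (gOfRecord₁₃ F N θ.toStage13Params p) p.K k → Sect2.TermValues (F.P p.K) (MatA N) (FluctV N) θ.τ9.M)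
      (Ek : SeqOfRecord F θ.ν θ.τ9.M (gOfRecord₁₃ F N θ.toStage13Params p) p.K k → ℝ),
      HasSect2FormAtZS F N (FluctV N) p.K (settingOfRecord₁₃ F N θ.toStage13Params p) k (θ.rzAt p) (WtOfRecord₁₃H F N θ p)
          (UbgOfRecord₁₃CoP F N θ.toStage13Params p k)
          (fun s₀ t₀ => Sect2.LawsRT (sect2TowerOfRecord F N (FluctV N) p.K (settingOfRecord₁₃ F N θ.toStage13Params p) (θ.rzAt p s₀) s₀ t₀)
            (settingOfRecord₁₃ F N θ.toStage13Params p).lf k)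
          (slotsOfRecord F N θ.ν θ.τ9 (EOfRecord₁₃ F N θ.toStage13Params) (wOfRecord₉ F N θ.toStage9Params) θ.ppSel p
            (gOfRecord₁₃ F N θ.toStage13Params p) k) t Ek ∧
      (∀ s₀, IsFluctLocal k (t s₀)) ∧
      ∀ (s : SeqOfRecord F θ.ν θ.τ9.M (gOfRecord₁₃ F N θ.toStage13Params p) p.K (k + 1)), s.Ω (k + 1) = ∅ →
        -- (P) prefix agreement below `k`
        (∀ j, j < k → (θ.zhAt p s).ζ0 j = (θ.zhAt p s.init).ζ0 j ∧ (θ.zhAt p s).quad j = (θ.zhAt p s.init).quad j) →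
        -- (V) the generation-`k` pin with the old front factor
        (∀ (V' : GaugeField (F.P p.K) (k + 1) (SU N)) (U₀ : GaugeField (F.P p.K) k (SU N)),
          (θ.zhAt p s).ζ0 k Set.univ (pairCfgAt (V := FluctV N) k V' U₀) =
            chiSeqOfRecord F N θ.ν θ.τ9.M (gOfRecord₁₃ F N θ.toStage13Params p) p.K k s.init U₀ *
              wOfRecord₉ F N θ.toStage9Params p (gOfRecord₁₃ F N θ.toStage13Params p) k s U₀ ((avOfRecord F N p.K k).avg U₀)) →
        -- `quad_k(∅) = 0` on the two-scale configurations
        (∀ (V' : GaugeField (F.P p.K) (k + 1) (SU N)) (U₀ : GaugeField (F.P p.K) k (SU N)), (θ.zhAt p s).quad k ∅ (pairCfgAt (V := FluctV N) k V' U₀) = 0) →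
        -- `k`-locality of `quad_j(Λ_{j+1})`, `j < k`
        (∀ j, j < k → ∀ ω ω' : MultiCfg (F.P p.K) (SU N) (FluctV N), (∀ i, i ≤ k → ω i = ω' i) →
          (θ.zhAt p s).quad j (s.init.Λ (j + 1)) ω = (θ.zhAt p s).quad j (s.init.Λ (j + 1)) ω') →
        -- measurability of the residual serving `s′`
        (∀ j (Y : Set (Site (F.P p.K) 0)), Measurable ((θ.zhAt p s).ζ0 j Y)) →
        (∀ j (Λ' : Set (Site (F.P p.K) 0)), Measurable ((θ.zhAt p s).quad j Λ')) →
        -- per old branch: A-fibre domination (K0b)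
        (∀ S ∈ admSOfRecord F θ.ν θ.τ9.M (gOfRecord₁₃ F N θ.toStage13Params p) p.K k s.init, ∀ j : ℕ,
          ∃ ŵ : (↥(Set.toFinite (B10Eq42TorusConstraint.bondsIn j ((s.init.Λ (j + 1))ᶜ ∩ s.init.Ω (j + 1)))).toFinset → FluctV N) → ℝ≥0∞, Measurable ŵ ∧
            (∫⁻ a, ŵ a ∂(Measure.pi fun _ : ↥(Set.toFinite (B10Eq42TorusConstraint.bondsIn j ((s.init.Λ (j + 1))ᶜ ∩ s.init.Ω (j + 1)))).toFinset => (volume : Measure (FluctV N)))) ≠ ⊤ ∧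
            ∀ ω, ENNReal.ofReal ((WtOfRecord₁₃H F N θ p s).w j (s.init.Λ (j + 1)) ((s.init.Λ (j + 1))ᶜ ∩ s.init.Ω (j + 1)) (S (j + 1)) ω) ≤
              ŵ (fun b : ↥(Set.toFinite (B10Eq42TorusConstraint.bondsIn j ((s.init.Λ (j + 1))ᶜ ∩ s.init.Ω (j + 1)))).toFinset => (ω j).2 b)) →
        -- def-T: the 𝐁-terms of the witness at the parent history, READ AT THE EMBEDDED BACKGROUND, are JOINTLY measurable in `(U, A)` (LOCATED residue)
        (∀ (S' : ℕ → Set (Site (F.P p.K) 0)) (j : ℕ) (X : (Sect2.domSys (F.P p.K) θ.τ9.M j).Dom),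
          Measurable (fun q : GaugeField (F.P p.K) 0 (SU N) × MSFluct (F.P p.K) (FluctV N) =>
            ((t s.init).B j X (Sect2.ofBackgroundC (settingOfRecord₁₃ F N θ.toStage13Params p).ι q.1) (S', q.2)).re)) →
        (slotsTOfRecord F N θ.ν θ.τ9 (EOfRecord₁₃ F N θ.toStage13Params) (wOfRecord₉ F N θ.toStage9Params) θ.ppSel p
            (gOfRecord₁₃ F N θ.toStage13Params p) (k + 1) s = 0 ∨
          ∀ᵐ V' ∂fieldMeasure (F.P p.K) (k + 1) (SU N),
            chiSeqOfRecord F N θ.ν θ.τ9.M (gOfRecord₁₃ F N θ.toStage13Params p) p.K (k + 1) s V' ≠ 0 →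
              slotsTOfRecord F N θ.ν θ.τ9 (EOfRecord₁₃ F N θ.toStage13Params) (wOfRecord₉ F N θ.toStage9Params) θ.ppSel p
                  (gOfRecord₁₃ F N θ.toStage13Params p) (k + 1) s V' =
                sect2Slot F N (FluctV N) p.K (settingOfRecord₁₃ F N θ.toStage13Params p) (θ.rzAt p s) (WtOfRecord₁₃H F N θ p s) s
                  (t s.init) (Ek s.init) (UbgOfRecord₁₃CoP F N θ.toStage13Params p (k + 1) s) V') :=
  exists_local_witness_clause_succ_of_sLaw₁₃CoPH_of_bgRead θ p hsep.toCore hU hθ hpos hk hM hw cR Γr hreg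
    ((hsep.bg p k hk.le hw hPC).mono fun s₀ Wc hWc => hJ s₀ Wc hWc.1 hWc.2) hS

end Record

end Summit.QuantumFields.YangMills.Theorems.BalabanUVNodesN11SpaceTruncation

end
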